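import Summits.QuantumFields.YangMills.Theorems.BalabanUVNodesN18KingModelTorus
import Literature.MathematicalPhysics.QuantumFieldTheory.King1986.MinimizerTwoSpacingDeriv

/-!
# BalabanUVNodes ∕ N18 — King's (3.73), SECOND BOUND (the lattice DERIVATIVE `∂_μ` on an external line), `j ≥ 1`, for
# King's ACTUAL operators on Bałaban's tori, UNCONDITIONAL: the (4.42) three-factor graph with the row `a_jG^η_jQ^*_j(x, ·)`
# replaced by its derivative row `∂^η_μ a_jG^η_jQ^*_j(x, ·)`, as a MULTI-SCALE inhabitant of `T4OutputRate.NE5` with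
# `θ = L^{−γ∕2}`, `κ > 0` (Track A, DAG node N18 = NE5 `T4OutputRate.NE5 EA EB W κ θ C₅` :211; cluster K4; the -a∕-b
# loop on the PRINTED MODEL, fifth display)

HONEST FRAMING.  Count-neutral kernel bookkeeping (seat pub-ymgap-dag-n18-a g4; `--supports stmt-QuantumFields-19182`).
King's A = 0 scalar MODEL of the NE5 mechanism (template literature, published and proved) — NOT Bałaban's covariant
one-step outputs `E^{(j)}(X; g, U)`, for which NE5 is NOT IN PRINT and has no tree producer (NODE O 0∕1); NOT a node
discharge; finite tori; nothing continuum ∕ ℝ⁴ ∕ OS ∕ mass-gap ∕ Clay.  THEOREMS ONLY: 0 `def`, 0 `sorry`, standard axioms.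

THE POINT.  King p. 665: «Proposition 3.9. For 0 ≤ j ≤ k − 1, 0 < α < 1, and γ sufficiently small,
|G^{(j)}_{k+n}(x′, y′) − G^{(j)}_k(x, y)|, |∂_μ^{η′}G^{(j)}_{k+n}(x′, y′) − ∂_μ^η G^{(j)}_k(x, y)| ≤ CL^{−γk}(L^jη)^{2−d−γ}
exp[−δ₀(L^jη)^{−1}|x − y|] (3.73)» and p. 675: «We will prove the first bound in (3.73); the other bounds follow in the
same way».  File 9 (`N18KingModelTorus.ne5_kingModel_threeFactor_torus`, p418046) is the FIRST bound for `j ≥ 1`; this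
file is the SECOND, «in the same way»: g3's knit `N18KingModelScales.ne5_of_threeFactorRates_lemma45` takes ARBITRARY rows,
so the derivative row `z ↦ ∂^η_μℋ_j(x, z) = L^j·(ℋ_j(x + e_μ, z) − ℋ_j(x, z))` is fed in with its Theorem-3.3 decay
(derivative clause) and its (3.71)-LINE-2 rate from seat n18-b's tenth file `King1986/MinimizerTwoSpacingDeriv` (p417945:
`dminimiser_row_decay`, `dminimiser_row_rate`; momentum core `MinimizerAliasRateDeriv` p416830), the column keeps
`minimiser_col_decay` ∕ `minimiser_row_rate` (`MinimizerBlockDecay` p416071), the middle line stays Lemma 4.5 ∕ (4.34) on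
the torus (inside the knit).
* §1 `dprop38RateConst_mono`, `dprop38Const_le_unif` (the derivative line's constant `C₁′(K,n) + C₂′` majorised by a
  `K, n`-free `C₅′(a, L, d, γ)` — `N18KingModel.lemma43Const_le_unif`), `douterRate_le_unif`
  (`√((C₁′(K,n)+C₂′)(L^K)^{−γ}·2ac₀) ≤ √(2ac₀C₅′)·(L^{−γ∕2})^K`).
* §2 **`ne5_kingModel_threeFactorDeriv_torus`** — for `d ≥ 1`, odd `L > 1`, `a > 0`, `m² > 0`, `0 ≤ γ < 1` there are
  `κ > 0`, `C₅ ≥ 0` (functions of `d, L, a, m², γ` ONLY) such that for EVERY `n ≥ 1`, every scale-indexed family of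
  Bałaban unit tori `L·M_j(μ) = 2L^{m_j}`, every carriers with `1 ≤ scale X` whose domains read a direction `μ(X)`, fine
  points `x_A, y_A` under `x_B, y_B` and `d X ≤ |B(x_A) − B(y_A)|_{T₁}`, every two functionals reading the graphs
  `Σ_{z,w} ∂^η_{μ}ℋ_j(x_A, z)·C^{(j)}(z, w)·ℋ_j(y_A, w)` (run A) and `Σ_{z,w} ∂^{η′}_{μ}ℋ_{j+n}(x_B, z)·C^{(j+n)}(z, w)·ℋ_{j+n}(y_B, w)`
  (run B), every window: **`NE5 EA EB W κ (L^{−γ∕2}) C₅`** — no analytic binder left.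
* §3 `ne5_kingModel_threeFactorDeriv_inhabited` — §2 on LITERAL carriers (`d X` = the block distance; D2).
NOT COVERED ∕ PINS (standing): A = 0, `g`∕`U` unread; periodic b.c.; `j = 0`; King's rescaling (2.20) and the factor
`(L^jη)^{2−d−γ}`∕`(L^jη)^{1−d−γ}`; the Hölder-quotient bounds (3.74)–(3.75) (lines 3–4 of (3.71): seat n18-b, next); vertex
functions; `γ = 1` (the derivative line's alias exponent needs `γ < 1`); Bałaban's `E^{(j)}(X; g, U)` — NIL bearing.

Sources: C. King, Commun. Math. Phys. **102** (1986) 649–677 [King1986] — Prop. 3.9 (3.73) p. 665, (4.42)–(4.43)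
p. 675, Prop. 3.8 (3.71) p. 664 (second line), Thm 3.3 (3.7) p. 658 (derivative clause), Lemma 4.5 (4.38) p. 674;
T. Bałaban, Commun. Math. Phys. **89** (1983) 571–597 [Balaban1983RegularityDecay] Thm (1.10) p. 573 clause 2 (via n18-b's
chain); Commun. Math. Phys. **109** (1987) 249–301 [Balaban1987RG1] Thm 1 p. 259.  No claim about the mass gap.
-/

noncomputable section

namespace Summit.QuantumFields.YangMills.BalabanUVNodes.N18KingModelTorusDeriv

open Real Matrix
open Literature.MathematicalPhysics.QuantumFieldTheory.Balaban1983to89 (Params)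
open Literature.MathematicalPhysics.QuantumFieldTheory.Balaban1983to89.T4OutputRate (Carriers Functional NE5)
open Literature.MathematicalPhysics.QuantumFieldTheory.Balaban1983to89.B5Prop11Plancherel (Tor fine unitVec)
open Literature.MathematicalPhysics.QuantumFieldTheory.Balaban1983to89.B4Sect5Proof (latticeConst latticeConst_nonneg)
open Literature.MathematicalPhysics.QuantumFieldTheory.King1986
  (aK lemma43Const prop38RateConst prop38PosConst nearRateConst centralRateConst dnearRateConst dcentralRateConst
    dprop38RateConst dprop38PosConst aliasConst aliasTerm_nonneg alias_sum_le)
open Literature.MathematicalPhysics.QuantumFieldTheory.King1986.Torus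
  (minimiser effLaplacian blockProj blockOf blockOf_over tdistT tdistT_symm tdistT_nonneg K45 K45_nonneg delta45 gam0L
    gam0L_pos delta45_pos minimiser_col_decay minimiser_row_rate dminimiser_row_decay dminimiser_row_rate)
open Summit.QuantumFields.YangMills.BalabanUVNodes.N18KingModel
  (lemma43Const_le_unif prop38Const_unif_nonneg rpow_neg_natPow kingTheta_eq_sq sqrt_mul_sq_mul coarse_val)
open Summit.QuantumFields.YangMills.BalabanUVNodes.N18KingModelScales (ne5_of_threeFactorRates_lemma45)
open Summit.QuantumFields.YangMills.BalabanUVNodes.N18KingModelTorus (outerRate_le_unif)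

variable {d : ℕ}

/-! ## §1 The derivative line's rate constant, uniform in `K` and `n` -/

/-- King's assembled derivative-line rate constant is monotone in the Lemma 4.3 letter `θ` (it enters linearly with
nonnegative coefficients). [cite: King1986, Prop. 3.8 (3.71) p.664 with (4.22)–(4.27) pp.672–673] -/
theorem dprop38RateConst_mono {aA aB θ θ' K : ℝ} {dd : ℕ} {γ : ℝ} (haA : 0 ≤ aA) (hK : 0 ≤ K)
    (hAC : 0 ≤ aliasConst dd γ) (hθ : θ ≤ θ') :
    dprop38RateConst aA aB θ K dd γ ≤ dprop38RateConst aA aB θ' K dd γ := by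
  have hpd : 0 ≤ (π / 2) ^ dd := pow_nonneg (by positivity) dd
  have h1 : nearRateConst aA θ dd γ ≤ nearRateConst aA θ' dd γ := by
    unfold nearRateConst
    exact mul_le_mul_of_nonneg_left (by nlinarith [pi_pos]) (mul_nonneg haA hpd)
  have h1' : dnearRateConst aA θ dd γ ≤ dnearRateConst aA θ' dd γ := by
    unfold dnearRateConst; linarith
  have h2 : centralRateConst aA θ K dd γ ≤ centralRateConst aA θ' K dd γ := by
    unfold centralRateConst
    refine mul_le_mul_of_nonneg_left ?_ hpd
    nlinarith [mul_nonneg hK (sq_nonneg π)]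
  have h2' : dcentralRateConst aA θ K dd γ ≤ dcentralRateConst aA θ' K dd γ := by
    unfold dcentralRateConst; nlinarith [pi_pos]
  unfold dprop38RateConst
  nlinarith [mul_le_mul_of_nonneg_right h1' hAC]

/-- **ONE CONSTANT FOR ALL SCALES (derivative line).**  `C₁′(k, n) + C₂′ ≤ C₅′(a, L, d, γ) := dprop38RateConst a a Θ (π²∕4)^d d γ
+ dprop38PosConst a (π²∕4)^d d γ`, `Θ = 2a((a(1 − L⁻²))⁻¹ + π²∕48 + 1∕3)` (`d ≥ 1`, `γ < 1`, `k, n ≥ 1`).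
[cite: King1986, Prop. 3.8 (3.71) p.664, Lemma 4.3 p.672, (2.13) p.653] -/
theorem dprop38Const_le_unif (hd : 0 < d) {a : ℝ} (ha : 0 < a) {L : ℕ} (hL : 2 ≤ L) {k n : ℕ} (hk : 1 ≤ k)
    (hn : 1 ≤ n) {γ : ℝ} (hγ : γ < 1) :
    dprop38RateConst a a (lemma43Const a L k n) ((π ^ 2 / 4) ^ d) d γ + dprop38PosConst a ((π ^ 2 / 4) ^ d) d γ
      ≤ dprop38RateConst a a (a * (2 * ((a * (1 - ((L : ℝ) ^ 2)⁻¹))⁻¹ + π ^ 2 / 48 + 1 / 3))) ((π ^ 2 / 4) ^ d) d γ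
        + dprop38PosConst a ((π ^ 2 / 4) ^ d) d γ := by
  have hAC : 0 ≤ aliasConst d γ :=
    (Finset.sum_nonneg fun j _ => aliasTerm_nonneg γ _ j).trans
      (alias_sum_le hd hγ (p := fun _ => 0) (fun μ => by rw [abs_zero]; exact pi_pos.le) 0)
  have h := dprop38RateConst_mono (aB := a) (K := (π ^ 2 / 4) ^ d) (dd := d) (γ := γ) ha.le (by positivity)
    hAC (lemma43Const_le_unif ha hL hk hn)
  linarith

/-- **One outer rate constant for all scales (derivative row).**  n18-b's (3.71)-line-2 constant
`√((C₁′(K,n) + C₂′)·(L^K)^{−γ}·2ac₀)` (`dminimiser_row_rate`) is at most `√(2ac₀·C₅′(a, L, d, γ))·(L^{−γ∕2})^K`.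
[cite: King1986, Prop. 3.8 (3.71) p.664] -/
theorem douterRate_le_unif (hd : 0 < d) {a : ℝ} (ha : 0 < a) {L : ℕ} (hL : 2 ≤ L) {K n : ℕ} (hK : 1 ≤ K) (hn : 1 ≤ n)
    {γ : ℝ} (hγ1 : γ < 1) {c₀ : ℝ} (hc₀ : 0 ≤ c₀) :
    Real.sqrt ((dprop38RateConst a a (lemma43Const a L K n) ((π ^ 2 / 4) ^ d) d γ
          + dprop38PosConst a ((π ^ 2 / 4) ^ d) d γ) * ((L ^ K : ℕ) : ℝ) ^ (-γ) * (2 * (a * c₀)))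
      ≤ Real.sqrt (2 * (a * c₀) *
            (dprop38RateConst a a (a * (2 * ((a * (1 - ((L : ℝ) ^ 2)⁻¹))⁻¹ + π ^ 2 / 48 + 1 / 3)))
                ((π ^ 2 / 4) ^ d) d γ
              + dprop38PosConst a ((π ^ 2 / 4) ^ d) d γ))
          * (((L : ℝ) ^ (-(γ / 2))) ^ K) := by
  set s : ℝ := (L : ℝ) ^ (-(γ / 2)) with hs_def
  have hs : 0 ≤ s := Real.rpow_nonneg (Nat.cast_nonneg _) _
  have hrate : ((L ^ K : ℕ) : ℝ) ^ (-γ) = (s ^ K) ^ 2 := by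
    rw [rpow_neg_natPow, kingTheta_eq_sq, ← pow_mul, ← pow_mul, mul_comm]
  set Ck : ℝ := dprop38RateConst a a (lemma43Const a L K n) ((π ^ 2 / 4) ^ d) d γ
    + dprop38PosConst a ((π ^ 2 / 4) ^ d) d γ with hCk
  set Cu : ℝ := dprop38RateConst a a (a * (2 * ((a * (1 - ((L : ℝ) ^ 2)⁻¹))⁻¹ + π ^ 2 / 48 + 1 / 3)))
      ((π ^ 2 / 4) ^ d) d γ + dprop38PosConst a ((π ^ 2 / 4) ^ d) d γ with hCu
  have hCle : Ck ≤ Cu := dprop38Const_le_unif hd ha hL hK hn hγ1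
  rw [hrate, sqrt_mul_sq_mul (pow_nonneg hs _)]
  have hmono : Real.sqrt (Ck * (2 * (a * c₀))) ≤ Real.sqrt (2 * (a * c₀) * Cu) := by
    rw [mul_comm Ck]
    exact Real.sqrt_le_sqrt (mul_le_mul_of_nonneg_left hCle (by positivity))
  exact mul_le_mul_of_nonneg_right hmono (pow_nonneg hs _)

/-! ## §2 (3.73), second bound, `j ≥ 1`, on Bałaban's tori: every outer line BY NAME -/

/-- **KING'S (3.73), SECOND BOUND (`∂_μ` ON THE LEFT EXTERNAL LINE), `j ≥ 1`, AS A MULTI-SCALE INHABITANT OF N18's DECL OF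
RECORD — UNCONDITIONAL FOR KING'S ACTUAL OPERATORS ON BAŁABAN'S TORI.**  For `d ≥ 1`, odd `L > 1`, `a > 0`, `m² > 0`,
`0 ≤ γ < 1` there are `κ > 0`, `C₅ ≥ 0` (functions of `d, L, a, m², γ` only) such that: for every `n ≥ 1`; every
scale-indexed family of unit tori with `L·M_j(μ) = 2L^{m_j}`; every carriers `C` with `1 ≤ scale X` whose domain `X` of
scale `j` reads a direction `μ(X)`, fine points `x_A(X)`, `y_A(X) ∈ T_η` UNDER `x_B(X)`, `y_B(X) ∈ T_{η′}` and has tree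
length at most `|B(x_A) − B(y_A)|_{T₁}`; every two functionals reading the (4.42) graphs with the DERIVATIVE row — run A
`Σ_{z,w} ∂^η_μℋ_j(x_A, z)·C^{(j)}(z, w)·ℋ_j(y_A, w)` with `∂^η_μℋ_j(x, z) = L^j·(ℋ_j(x + e_μ, z) − ℋ_j(x, z))`, run B
`Σ_{z,w} ∂^{η′}_μℋ_{j+n}(x_B, z)·C^{(j+n)}(z, w)·ℋ_{j+n}(y_B, w)` (King's ACTUAL `A = 0` operators of the tree); every window:
`NE5 EA EB W κ (L^{−γ∕2}) C₅`.  Composition: `ne5_of_threeFactorRates_lemma45` at `γ∕2` with `hu` ≔ `dminimiser_row_decay`,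
`hdu` ≔ `dminimiser_row_rate` ∘ `douterRate_le_unif`, `hv` ≔ `minimiser_col_decay` ∘ `blockOf_over`, `hdv` ≔
`minimiser_row_rate` ∘ `N18KingModelTorus.outerRate_le_unif` ∘ `tdistT_symm`, common rate
`κ = min(δ₀^{∂row}, δ₀^{col}, δ₀^{∂rate}∕2, δ₀^{rate}∕2, δ₄₅)`. [cite: King1986, Prop. 3.9 (3.73) p.665, (4.42)–(4.43) p.675, Prop. 3.8 (3.71) p.664] -/
theorem ne5_kingModel_threeFactorDeriv_torus (hd : 1 ≤ d) (L : ℕ) [NeZero L] (hLp : Odd L ∧ 1 < L) {a m2 : ℝ}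
    (ha : 0 < a) (hm : 0 < m2) {γ : ℝ} (hγ0 : 0 ≤ γ) (hγ1 : γ < 1) :
    ∃ κ C₅ : ℝ, 0 < κ ∧ 0 ≤ C₅ ∧
      ∀ (n : ℕ) (_hn : 1 ≤ n) (M : ℕ → Fin d → ℕ) [∀ j μ, NeZero (M j μ)]
        (_hM : ∀ j, ∃ mm : ℕ, ∀ μ, L * M j μ = 2 * L ^ mm)
        (C : Carriers) (_hsc : ∀ X, 1 ≤ C.scale X) (dir : C.Dom → Fin d)
        (xA yA : (X : C.Dom) → Tor (fine (L ^ C.scale X) (fine L (M (C.scale X)))))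
        (xB yB : (X : C.Dom) → Tor (fine (L ^ n * L ^ C.scale X) (fine L (M (C.scale X)))))
        (_hx : ∀ X μ, (xA X μ).val = (xB X μ).val / L ^ n)
        (_hy : ∀ X μ, (yA X μ).val = (yB X μ).val / L ^ n)
        (_hd : ∀ X, C.d X ≤ tdistT (fine L (M (C.scale X)))
            (blockOf (L ^ C.scale X) (fine L (M (C.scale X))) (xA X))
            (blockOf (L ^ C.scale X) (fine L (M (C.scale X))) (yA X)))
        (EA : Functional C C.BgA) (EB : Functional C C.BgB)
        (_hEA : ∀ g U X, EA g U X =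
          (fun z => ((L ^ C.scale X : ℕ) : ℝ)
              * (minimiser (L ^ C.scale X) (fine L (M (C.scale X))) (aK a L (C.scale X))
                    (((L ^ C.scale X : ℕ) : ℝ) ^ 2) m2 (Pi.single z 1)
                    (xA X + unitVec (fine (L ^ C.scale X) (fine L (M (C.scale X)))) (dir X))
                  - minimiser (L ^ C.scale X) (fine L (M (C.scale X))) (aK a L (C.scale X))
                    (((L ^ C.scale X : ℕ) : ℝ) ^ 2) m2 (Pi.single z 1) (xA X)))
            ⬝ᵥ ((effLaplacian (L ^ C.scale X) (fine L (M (C.scale X))) (aK a L (C.scale X))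
                    (((L ^ C.scale X : ℕ) : ℝ) ^ 2) m2
                  + (a * ((L : ℝ) ^ 2)⁻¹) • blockProj L (M (C.scale X)))⁻¹
                *ᵥ fun w => minimiser (L ^ C.scale X) (fine L (M (C.scale X))) (aK a L (C.scale X))
                    (((L ^ C.scale X : ℕ) : ℝ) ^ 2) m2 (Pi.single w 1) (yA X)))
        (_hEB : ∀ g U X, EB g U X =
          (fun z => ((L ^ n * L ^ C.scale X : ℕ) : ℝ)
              * (minimiser (L ^ n * L ^ C.scale X) (fine L (M (C.scale X))) (aK a L (C.scale X + n))
                    (((L ^ n * L ^ C.scale X : ℕ) : ℝ) ^ 2) m2 (Pi.single z 1)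
                    (xB X + unitVec (fine (L ^ n * L ^ C.scale X) (fine L (M (C.scale X)))) (dir X))
                  - minimiser (L ^ n * L ^ C.scale X) (fine L (M (C.scale X))) (aK a L (C.scale X + n))
                    (((L ^ n * L ^ C.scale X : ℕ) : ℝ) ^ 2) m2 (Pi.single z 1) (xB X)))
            ⬝ᵥ ((effLaplacian (L ^ n * L ^ C.scale X) (fine L (M (C.scale X))) (aK a L (C.scale X + n))
                    (((L ^ n * L ^ C.scale X : ℕ) : ℝ) ^ 2) m2
                  + (a * ((L : ℝ) ^ 2)⁻¹) • blockProj L (M (C.scale X)))⁻¹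
                *ᵥ fun w => minimiser (L ^ n * L ^ C.scale X) (fine L (M (C.scale X))) (aK a L (C.scale X + n))
                    (((L ^ n * L ^ C.scale X : ℕ) : ℝ) ^ 2) m2 (Pi.single w 1) (yB X)))
        (W : Set (ℕ → ℝ)),
        NE5 EA EB W κ ((L : ℝ) ^ (-(γ / 2))) C₅ := by
  have hd0 : 0 < d := hd
  have hL2 : 2 ≤ L := by have := hLp.2; omega
  have hγ1' : γ ≤ 1 := hγ1.le
  -- the outer-line packages of n18-b (Theorem 3.3 both clauses ∕ (3.71) lines 1 and 2, block-distance currency), BY NAME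
  obtain ⟨δ₁, c₁, hδ₁, hc₁, H₁⟩ := dminimiser_row_decay d L hd hLp ha hm.le
  obtain ⟨δ₂, c₂, hδ₂, hc₂, H₂⟩ := minimiser_col_decay d L hd hLp ha hm.le
  obtain ⟨δ₃, c₃, hδ₃, hc₃, H₃⟩ := dminimiser_row_rate d L hd hLp.1 hL2 ha hm hγ0 hγ1
  obtain ⟨δ₄, c₄, hδ₄, hc₄, H₄⟩ := minimiser_row_rate d L hd hLp.1 hL2 ha hm hγ0 hγ1'
  -- one common decay rate
  have hδ45 : 0 < delta45 d a L := delta45_pos (d := d) ha hL2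
  set κ : ℝ := min (min (min δ₁ δ₂) (min (δ₃ / 2) (δ₄ / 2))) (delta45 d a L) with hκ_def
  have hκpos : 0 < κ :=
    lt_min (lt_min (lt_min hδ₁ hδ₂) (lt_min (half_pos hδ₃) (half_pos hδ₄))) hδ45
  have hκ₁ : κ ≤ δ₁ := (min_le_left _ _).trans ((min_le_left _ _).trans (min_le_left _ _))
  have hκ₂ : κ ≤ δ₂ := (min_le_left _ _).trans ((min_le_left _ _).trans (min_le_right _ _))
  have hκ₃ : κ ≤ δ₃ / 2 := (min_le_left _ _).trans ((min_le_right _ _).trans (min_le_left _ _))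
  have hκ₄ : κ ≤ δ₄ / 2 := (min_le_left _ _).trans ((min_le_right _ _).trans (min_le_right _ _))
  have hκ45 : κ ≤ delta45 d a L := min_le_right _ _
  -- the uniform letters
  set Cu : ℝ := prop38RateConst a a (a * (2 * ((a * (1 - ((L : ℝ) ^ 2)⁻¹))⁻¹ + π ^ 2 / 48 + 1 / 3)))
      ((π ^ 2 / 4) ^ d) d γ + prop38PosConst a ((π ^ 2 / 4) ^ d) d γ with hCu
  set Cu' : ℝ := dprop38RateConst a a (a * (2 * ((a * (1 - ((L : ℝ) ^ 2)⁻¹))⁻¹ + π ^ 2 / 48 + 1 / 3)))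
      ((π ^ 2 / 4) ^ d) d γ + dprop38PosConst a ((π ^ 2 / 4) ^ d) d γ with hCu'
  set cA : ℝ := Real.sqrt (2 * (a * c₃) * Cu') with hcA
  set cB : ℝ := Real.sqrt (2 * (a * c₄) * Cu) with hcB
  have hcA0 : 0 ≤ cA := Real.sqrt_nonneg _
  have hcB0 : 0 ≤ cB := Real.sqrt_nonneg _
  have hsA : 0 ≤ a * c₁ := by positivity
  have hsB : 0 ≤ a * c₂ := by positivity
  have hγ₀ : 0 < gam0L d a L := gam0L_pos ha hL2
  have hK45 : 0 ≤ K45 d a L := K45_nonneg a L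
  have hKd : 0 ≤ latticeConst d (κ / 2) := latticeConst_nonneg d (half_pos hκpos).le
  refine ⟨κ / 2, (cA * (2 / gam0L d a L) * (a * c₂) + a * c₁ * K45 d a L * (a * c₂)
      + a * c₁ * (2 / gam0L d a L) * cB) * (latticeConst d (κ / 2)) ^ 2, half_pos hκpos, by positivity, ?_⟩
  intro n hn M _ hM C hsc dir xA yA xB yB hx hy hdd EA EB hEA hEB W
  have hγ2 : γ / 2 ≤ 1 := by linarith
  refine ne5_of_threeFactorRates_lemma45 (C := C) (EA := EA) (EB := EB) (W := W) L hL2 ha hm hn M hγ2 hsc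
    (fun X => blockOf (L ^ C.scale X) (fine L (M (C.scale X))) (xA X))
    (fun X => blockOf (L ^ C.scale X) (fine L (M (C.scale X))) (yA X))
    (fun X z => ((L ^ C.scale X : ℕ) : ℝ)
      * (minimiser (L ^ C.scale X) (fine L (M (C.scale X))) (aK a L (C.scale X))
            (((L ^ C.scale X : ℕ) : ℝ) ^ 2) m2 (Pi.single z 1)
            (xA X + unitVec (fine (L ^ C.scale X) (fine L (M (C.scale X)))) (dir X))
          - minimiser (L ^ C.scale X) (fine L (M (C.scale X))) (aK a L (C.scale X))
            (((L ^ C.scale X : ℕ) : ℝ) ^ 2) m2 (Pi.single z 1) (xA X)))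
    (fun X z => ((L ^ n * L ^ C.scale X : ℕ) : ℝ)
      * (minimiser (L ^ n * L ^ C.scale X) (fine L (M (C.scale X))) (aK a L (C.scale X + n))
            (((L ^ n * L ^ C.scale X : ℕ) : ℝ) ^ 2) m2 (Pi.single z 1)
            (xB X + unitVec (fine (L ^ n * L ^ C.scale X) (fine L (M (C.scale X)))) (dir X))
          - minimiser (L ^ n * L ^ C.scale X) (fine L (M (C.scale X))) (aK a L (C.scale X + n))
            (((L ^ n * L ^ C.scale X : ℕ) : ℝ) ^ 2) m2 (Pi.single z 1) (xB X)))
    (fun X w => minimiser (L ^ C.scale X) (fine L (M (C.scale X))) (aK a L (C.scale X))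
      (((L ^ C.scale X : ℕ) : ℝ) ^ 2) m2 (Pi.single w 1) (yA X))
    (fun X w => minimiser (L ^ n * L ^ C.scale X) (fine L (M (C.scale X))) (aK a L (C.scale X + n))
      (((L ^ n * L ^ C.scale X : ℕ) : ℝ) ^ 2) m2 (Pi.single w 1) (yB X))
    (fun X => (effLaplacian (L ^ C.scale X) (fine L (M (C.scale X))) (aK a L (C.scale X))
        (((L ^ C.scale X : ℕ) : ℝ) ^ 2) m2 + (a * ((L : ℝ) ^ 2)⁻¹) • blockProj L (M (C.scale X)))⁻¹)
    (fun X => (effLaplacian (L ^ n * L ^ C.scale X) (fine L (M (C.scale X))) (aK a L (C.scale X + n))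
        (((L ^ n * L ^ C.scale X : ℕ) : ℝ) ^ 2) m2 + (a * ((L : ℝ) ^ 2)⁻¹) • blockProj L (M (C.scale X)))⁻¹)
    (fun _ => rfl) (fun _ => rfl) hκpos hκ45 hsA hsB hcA0 hcB0 ?_ ?_ ?_ ?_ hdd hEA hEB
  · -- `hu`: run A's DERIVATIVE row, Theorem 3.3's derivative clause in block-distance currency (`dminimiser_row_decay`)
    intro X z
    obtain ⟨mm, hmm⟩ := hM (C.scale X)
    have hMK : ∀ μ, fine L (M (C.scale X)) μ
        = (⟨d, L, mm, C.scale X, hd, hLp⟩ : Params).sitesPerDir (C.scale X) := fun μ => by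
      simp only [Params.sitesPerDir, Nat.add_sub_cancel]; exact hmm μ
    exact H₁ ⟨d, L, mm, C.scale X, hd, hLp⟩ rfl rfl (hsc X) (fine L (M (C.scale X))) hMK (L ^ C.scale X) rfl
      κ hκpos hκ₁ (xA X) z (dir X)
  · -- `hv`: run B's column (`minimiser_col_decay`), the block under `y_B` is `B(y_A)` (`blockOf_over`)
    intro X w
    obtain ⟨mm, hmm⟩ := hM (C.scale X)
    have hMK : ∀ μ, fine L (M (C.scale X)) μ
        = (⟨d, L, mm, C.scale X + n, hd, hLp⟩ : Params).sitesPerDir (C.scale X + n) := fun μ => by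
      simp only [Params.sitesPerDir, Nat.add_sub_cancel]; exact hmm μ
    have hN : L ^ n * L ^ C.scale X = L ^ (C.scale X + n) := by rw [pow_add, mul_comm]
    have h := H₂ ⟨d, L, mm, C.scale X + n, hd, hLp⟩ rfl rfl (show 1 ≤ C.scale X + n by have := hsc X; omega)
      (fine L (M (C.scale X))) hMK (L ^ n * L ^ C.scale X) hN κ hκpos hκ₂ (yB X) w
    rw [blockOf_over (fine L (M (C.scale X))) (yA X) (yB X) (hy X)] at h
    exact h
  · -- `hdu`: the DERIVATIVE row difference, (3.71) line 2 in block currency (`dminimiser_row_rate`) + `douterRate_le_unif`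
    intro X z
    obtain ⟨mm, hmm⟩ := hM (C.scale X)
    have hMK : ∀ μ, fine L (M (C.scale X)) μ
        = (⟨d, L, mm, C.scale X, hd, hLp⟩ : Params).sitesPerDir (C.scale X) := fun μ => by
      simp only [Params.sitesPerDir, Nat.add_sub_cancel]; exact hmm μ
    haveI : NeZero (⟨d, L, mm, C.scale X, hd, hLp⟩ : Params).L := ‹NeZero L›
    have h := H₃ ⟨d, L, mm, C.scale X, hd, hLp⟩ rfl rfl (hsc X) n hn (fine L (M (C.scale X))) hMK κ hκpos hκ₃
      (xA X) (xB X) z (hx X) (dir X)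
    exact h.trans (mul_le_mul_of_nonneg_right (douterRate_le_unif hd0 ha hL2 (hsc X) hn hγ1 hc₃.le)
      (Real.exp_pos _).le)
  · -- `hdv`: the column difference, (3.71) line 1 (`minimiser_row_rate`) by symmetry of the torus distance
    intro X w
    obtain ⟨mm, hmm⟩ := hM (C.scale X)
    have hMK : ∀ μ, fine L (M (C.scale X)) μ
        = (⟨d, L, mm, C.scale X, hd, hLp⟩ : Params).sitesPerDir (C.scale X) := fun μ => by
      simp only [Params.sitesPerDir, Nat.add_sub_cancel]; exact hmm μ
    haveI : NeZero (⟨d, L, mm, C.scale X, hd, hLp⟩ : Params).L := ‹NeZero L›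
    have h := H₄ ⟨d, L, mm, C.scale X, hd, hLp⟩ rfl rfl (hsc X) n hn (fine L (M (C.scale X))) hMK κ hκpos hκ₄
      (yA X) (yB X) w (hy X)
    rw [tdistT_symm (fine L (M (C.scale X))) w]
    exact h.trans (mul_le_mul_of_nonneg_right (outerRate_le_unif hd0 ha hL2 (hsc X) hn hγ1' hc₄.le)
      (Real.exp_pos _).le)

/-! ## §3 A LITERAL inhabitant: the derivative graphs on King's own carriers (§2's binders jointly satisfiable, `d X` =
the block distance) -/

/-- **§2 INHABITED IN THE KERNEL.**  On the LITERAL carriers whose domains are a scale `j` (creation scale `j + 1`), a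
direction `μ` and a pair of run-B fine points `x′, y′`, with `d X := |B(x) − B(y)|_{T₁}` for the run-A points `x, y` under
`x′, y′`, trivial backgrounds, transport `id`, gauge `0`, the functionals reading the derivative graphs of run A at
`(μ, x, y)` and of run B at `(μ, x′, y′)` satisfy `NE5 … κ (L^{−γ∕2}) C₅` with §2's letters for every `n ≥ 1`, every
Bałaban unit torus `L·M′(μ) = 2L^{m}` and every window (`hx`, `hy` ≔ `coarse_val`, `hd` ≔ `le_rfl`, `hEA`, `hEB` ≔ `rfl`).
[cite: King1986, Prop. 3.9 (3.73) p.665, (4.42) p.675] -/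
theorem ne5_kingModel_threeFactorDeriv_inhabited (hd : 1 ≤ d) (L : ℕ) [NeZero L] (hLp : Odd L ∧ 1 < L) {a m2 : ℝ}
    (ha : 0 < a) (hm : 0 < m2) {γ : ℝ} (hγ0 : 0 ≤ γ) (hγ1 : γ < 1) :
    ∃ κ C₅ : ℝ, 0 < κ ∧ 0 ≤ C₅ ∧
      ∀ (n : ℕ) (_hn : 1 ≤ n) (M' : Fin d → ℕ) [∀ μ, NeZero (M' μ)] (_hM' : ∃ mm : ℕ, ∀ μ, L * M' μ = 2 * L ^ mm)
        (W : Set (ℕ → ℝ)),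
        NE5 (C := { Dom := Σ j : ℕ, Fin d × (Tor (fine (L ^ n * L ^ (j + 1)) (fine L M'))
                                           × Tor (fine (L ^ n * L ^ (j + 1)) (fine L M'))),
                    scale := fun X => X.1 + 1,
                    d := fun X => tdistT (fine L M')
                      (blockOf (L ^ (X.1 + 1)) (fine L M')
                        (fun μ => (((X.2.2.1 μ).val / L ^ n : ℕ) : ZMod (fine (L ^ (X.1 + 1)) (fine L M') μ))))
                      (blockOf (L ^ (X.1 + 1)) (fine L M')
                        (fun μ => (((X.2.2.2 μ).val / L ^ n : ℕ) : ZMod (fine (L ^ (X.1 + 1)) (fine L M') μ)))),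
                    d_nonneg := fun _ => tdistT_nonneg _ _ _,
                    BgA := PUnit, BgB := PUnit, gauge := fun _ _ => 0, gauge_nonneg := fun _ _ => le_rfl,
                    transport := id })
          (fun (_ : ℕ → ℝ) (_ : PUnit)
              (X : Σ j : ℕ, Fin d × (Tor (fine (L ^ n * L ^ (j + 1)) (fine L M'))
                                     × Tor (fine (L ^ n * L ^ (j + 1)) (fine L M')))) =>
            (fun z => ((L ^ (X.1 + 1) : ℕ) : ℝ)
                * (minimiser (L ^ (X.1 + 1)) (fine L M') (aK a L (X.1 + 1)) (((L ^ (X.1 + 1) : ℕ) : ℝ) ^ 2) m2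
                      (Pi.single z 1)
                      ((fun μ => (((X.2.2.1 μ).val / L ^ n : ℕ) : ZMod (fine (L ^ (X.1 + 1)) (fine L M') μ)))
                        + unitVec (fine (L ^ (X.1 + 1)) (fine L M')) X.2.1)
                    - minimiser (L ^ (X.1 + 1)) (fine L M') (aK a L (X.1 + 1)) (((L ^ (X.1 + 1) : ℕ) : ℝ) ^ 2) m2
                      (Pi.single z 1)
                      (fun μ => (((X.2.2.1 μ).val / L ^ n : ℕ) : ZMod (fine (L ^ (X.1 + 1)) (fine L M') μ)))))
              ⬝ᵥ ((effLaplacian (L ^ (X.1 + 1)) (fine L M') (aK a L (X.1 + 1)) (((L ^ (X.1 + 1) : ℕ) : ℝ) ^ 2) m2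
                      + (a * ((L : ℝ) ^ 2)⁻¹) • blockProj L M')⁻¹
                  *ᵥ fun w => minimiser (L ^ (X.1 + 1)) (fine L M') (aK a L (X.1 + 1))
                      (((L ^ (X.1 + 1) : ℕ) : ℝ) ^ 2) m2 (Pi.single w 1)
                      (fun μ => (((X.2.2.2 μ).val / L ^ n : ℕ) : ZMod (fine (L ^ (X.1 + 1)) (fine L M') μ)))))
          (fun (_ : ℕ → ℝ) (_ : PUnit)
              (X : Σ j : ℕ, Fin d × (Tor (fine (L ^ n * L ^ (j + 1)) (fine L M'))
                                     × Tor (fine (L ^ n * L ^ (j + 1)) (fine L M')))) =>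
            (fun z => ((L ^ n * L ^ (X.1 + 1) : ℕ) : ℝ)
                * (minimiser (L ^ n * L ^ (X.1 + 1)) (fine L M') (aK a L (X.1 + 1 + n))
                      (((L ^ n * L ^ (X.1 + 1) : ℕ) : ℝ) ^ 2) m2 (Pi.single z 1)
                      (X.2.2.1 + unitVec (fine (L ^ n * L ^ (X.1 + 1)) (fine L M')) X.2.1)
                    - minimiser (L ^ n * L ^ (X.1 + 1)) (fine L M') (aK a L (X.1 + 1 + n))
                      (((L ^ n * L ^ (X.1 + 1) : ℕ) : ℝ) ^ 2) m2 (Pi.single z 1) X.2.2.1))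
              ⬝ᵥ ((effLaplacian (L ^ n * L ^ (X.1 + 1)) (fine L M') (aK a L (X.1 + 1 + n))
                      (((L ^ n * L ^ (X.1 + 1) : ℕ) : ℝ) ^ 2) m2 + (a * ((L : ℝ) ^ 2)⁻¹) • blockProj L M')⁻¹
                  *ᵥ fun w => minimiser (L ^ n * L ^ (X.1 + 1)) (fine L M') (aK a L (X.1 + 1 + n))
                      (((L ^ n * L ^ (X.1 + 1) : ℕ) : ℝ) ^ 2) m2 (Pi.single w 1) X.2.2.2))
          W κ ((L : ℝ) ^ (-(γ / 2))) C₅ := by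
  obtain ⟨κ, C₅, hκ, hC₅, H⟩ := ne5_kingModel_threeFactorDeriv_torus hd L hLp ha hm hγ0 hγ1
  refine ⟨κ, C₅, hκ, hC₅, ?_⟩
  intro n hn M' _ hM' W
  have hLn : 0 < L ^ n := pow_pos (Nat.pos_of_ne_zero (NeZero.ne L)) n
  -- the carriers literal is repeated so that the reading maps elaborate against a closed structure
  exact H n hn (fun _ => M') (fun _ => hM')
    { Dom := Σ j : ℕ, Fin d × (Tor (fine (L ^ n * L ^ (j + 1)) (fine L M'))
                             × Tor (fine (L ^ n * L ^ (j + 1)) (fine L M'))),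
      scale := fun X => X.1 + 1,
      d := fun X => tdistT (fine L M')
        (blockOf (L ^ (X.1 + 1)) (fine L M')
          (fun μ => (((X.2.2.1 μ).val / L ^ n : ℕ) : ZMod (fine (L ^ (X.1 + 1)) (fine L M') μ))))
        (blockOf (L ^ (X.1 + 1)) (fine L M')
          (fun μ => (((X.2.2.2 μ).val / L ^ n : ℕ) : ZMod (fine (L ^ (X.1 + 1)) (fine L M') μ)))),
      d_nonneg := fun _ => tdistT_nonneg _ _ _,
      BgA := PUnit, BgB := PUnit, gauge := fun _ _ => 0, gauge_nonneg := fun _ _ => le_rfl, transport := id }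
    (fun _ => Nat.succ_le_succ (Nat.zero_le _)) (fun X => X.2.1)
    (fun X μ => (((X.2.2.1 μ).val / L ^ n : ℕ) : ZMod (fine (L ^ (X.1 + 1)) (fine L M') μ)))
    (fun X μ => (((X.2.2.2 μ).val / L ^ n : ℕ) : ZMod (fine (L ^ (X.1 + 1)) (fine L M') μ)))
    (fun X => X.2.2.1) (fun X => X.2.2.2)
    (fun X μ => coarse_val hLn X.2.2.1 μ) (fun X μ => coarse_val hLn X.2.2.2 μ)
    (fun _ => le_rfl) _ _ (fun _ _ _ => rfl) (fun _ _ _ => rfl) W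

end Summit.QuantumFields.YangMills.BalabanUVNodes.N18KingModelTorusDeriv

end
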